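import Literature.AnabelianGeometry.EtaleTheta.KummerContainerValuationLawsNumberField
import Literature.AnabelianGeometry.EtaleTheta.CyclotomeAutZHat
import Literature.IUT.HodgeTheaters.GlobalFrobenioidsCyclotomeIsoOfIntegralLaws
import Literature.IUT.HodgeTheaters.GlobalFrobenioidsCyclotomes
import HarnessLib

/-!
# [IUTchI] Example 5.1 (v), p. 128, second display — `UniqueCyclotomeIsoFamily` AT THE GENUINE KUMMER
# CONTAINER OF A NUMBER FIELD (proof-only; sub-DAG row E51/L28, GAP-LEDGER G-w4d057g4-1)

S. Mochizuki, *Inter-universal Teichmüller theory I*, kurims manuscript (May 2020), §5 Example 5.1 (v), p. 128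
l. 25–49 ([IUTchI] Ex 5.1 (v) p.128) [claim: Mochizuki2012, status: disputed]: "it follows immediately from the
theory summarized in [AbsTopIII], Theorem 1.9, (d), that there exists a unique isomorphism of cyclotomes
`μ^Θ_Ẑ(π₁(†𝒟^⊚)) ⥲ μ_Ẑ(†𝕄^⊛)` such that the resulting isomorphism between direct limits of cohomology modules
induces isomorphisms `𝕄^⊛(†𝒟^⊚) ⥲ †𝕄^⊛`, `𝕄^⊛_sol(†𝒟^⊚) ⥲ †𝕄^⊛_sol`, `𝕄^⊛_mod(†𝒟^⊚) ⥲ †𝕄^⊛_mod` … in a fashion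
that is compatible with the integral submonoids `𝒪^⊿_𝔭`"; (iv) p. 126 l. 19–38: `𝒪^×(A^birat)` "may be naturally
identified with the multiplicative group of nonzero elements of the number field corresponding to `A`", `𝒪^⊿_𝔭` =
"the submonoid of integral elements … with respect to the valuation determined by `𝔭`"; uniqueness rests (p. 127)
on "`ℚ_{>0} ∩ Ẑ^× = {1}`".  Container / Kummer map: LANA Project interim report [LANA2026Report], §6.1 pp. 31–32.

Cell abc-iut; PROOF-ONLY companion (theorems only: no `def`, no `instance`, no `structure`, no new `Prop` fact) of
abc-iut-L5-t12's `GlobalFrobenioidsCyclotomes.lean` (`CyclotomeComparisonFamily`, `UniqueCyclotomeIsoFamily` =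
FACT-LIST F-2577); node IUTchI:Ex5.1(v); sub-DAG row E51/L28; GAP-LEDGER G-w4d057g4-1, whose disposition rows
(abc-iut-w4-d057 08:59Z, abc-iut-w4-d035 09:45Z) left open exactly "the identification of the free
`CyclotomeComparisonFamily` with the genuine container + laws (E)/(T)".  State before: the closer of record
`UniqueCyclotomeIsoFamily.of_integral_laws` (abc-iut-w4-d057) binds five laws (E)(T)(V)(I)(P) over the FREE record;
(V)(I)(P) are theorems at the Kummer container of a number field (`exists_valuation_laws_numberField`, abc-iut-w4-d035,
on `valuationTransport_law`, abc-iut-w4-d057); the container's `Ẑ^×`-module structure `H1ColimTwist` and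
`Aut(Λ(K̄ˣ)) = Ẑ^×` on the nose (`cyclotome.zhatTwist_bijective_of_isSepClosed`) are abc-iut-w4-d056's; the only
kernel instance at which the closer fired was abc-iut-f-189's `CyclotomeComparisonFamily.exists_zhatModel_integral_laws`
— genuine cyclotome `Ẑ`, DEGENERATE container (`Ẑ` itself, one valuation coordinate).

**This file: the display AT THE GENUINE ARITHMETIC CONTAINER.**  `k` a number field [`F_mod`, p. 126], `k̄` an
algebraic closure, `S` a directed exhaustive system of subgroups of `Γ_k` each containing some `Gal(k̄/L)`, `L/k`
finite [e.g. the open subgroups], `H := lim_{→ i} H¹(S i, Λ(k̄ˣ))` with Kummer map `κ : k̄ˣ → H`.  The comparison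
family: target cyclotome `Λ(k̄ˣ) = μ_Ẑ(†𝕄^⊛)`; source ANY abstract cyclotome `μ` with a CHOSEN identification
`e₀ : μ ⥲ Λ(k̄ˣ)` [print: the isomorphism furnished by [AbsTopIII] Thm 1.9 (d) — existence, law (E), is that FACT,
consumed as the datum `e₀`, not proved]; both containers `H` [the étale-side `lim H¹(H, μ^Θ)` transported along the
isomorphism `e₀` induces — how Thm 1.9 (d) "constructs" `𝕄^⊛(†𝒟^⊚)` inside it]; layers ANY family `L` with
`L i₀ = κ(kˣ)` [`F_mod^×`; for `ι = AstLayer`: `⊛ ↦ κ(k̄ˣ)`, `sol ↦ κ(Fˣ)`, `mod ↦ κ(kˣ)`]; integral submonoids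
`κ({x ∈ kˣ : v_𝔭(x) ≤ 1})` for EVERY finite prime `𝔭`; induced map of `e : μ ⥲ Λ(k̄ˣ)` := the container twist by the
cyclotomic parameter `u_e ∈ Ẑ^× = Aut(Ẑ)` of `e ∘ e₀⁻¹ ∈ Aut(Λ(k̄ˣ))` [functoriality of `lim H¹(S i, −)` in the
coefficients].  Proved: `KummerContainer.eq_one_of_mapsTo_layer_integral` — **`Ẑ^×`-RIGIDITY OF THE CONTAINER**:
`u ∈ Ẑ^×` whose twist carries `κ(kˣ)` into itself and `κ(𝒪^⊿_𝔭)` into itself for ONE finite `𝔭` is `1` [(V)(I) + a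
uniformiser + `ℚ_{>0} ∩ Ẑ^× = {1}` (`CyclotomeRigidity.eq_one_of_pos_of_nonneg`)], and its `Aut(Λ(k̄ˣ))` form;
`numberFieldModel_inducesCompatibleIsos_iff` — the such-that clause holds IFF `e = e₀`;
`uniqueCyclotomeIsoFamily_numberFieldModel` — **`UniqueCyclotomeIsoFamily` HOLDS** (F-2577 at genuine data);
`numberFieldModel_integral_laws` — ALL FIVE hypotheses (E)(T)(V)(I)(P) of the closer of record hold there, with the
GENUINE torsor law (T) [`zμ u e := (twist by u) ∘ e`, container action `H1ColimTwist`, functoriality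
`H1ColimTwist_mul_apply`], and the closer FIRES; `uniqueCyclotomeIsoFamily_numberField_astLayer` — the `AstLayer`
instance with the three printed layers (`e₀ = id`: the unique isomorphism is the identity of `Λ(k̄ˣ)`).

HONEST FRAMING: classical Kummer theory of number fields and `Ẑ`-bookkeeping, OUR kernel check.  The étale-side
cyclotome and container are MODELLED by an abstract cyclotome identified with `Λ(k̄ˣ)` along a chosen `e₀`
(existence = [AbsTopIII] Thm 1.9 (d), FACT-policy, a datum here); the equivariance clause "[of monoids equipped with
continuous actions by `π₁(†𝒟^⊛)`]" is not part of the record and is not modelled.  Nothing here asserts a statement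
of the disputed series or takes a side on [IUTchIII] Cor. 3.12; typed ≠ proved.  Universe `Type` (Mathlib
`groupCohomology`), as in the Kummer files.
-/

noncomputable section

open CategoryTheory groupCohomology ProfiniteGrp ProfiniteGrp.ProfiniteCompletion NumberField IsDedekindDomain
open Literature.AnabelianGeometry.EtaleTheta Literature.AnabelianGeometry.EtaleTheta.ZHatLevel

namespace Literature.IUT.HodgeTheaters

universe w

variable (k : Type) [Field k] [NumberField k] {ι₀ : Type} [Preorder ι₀] [DecidableEq ι₀] [IsDirectedOrder ι₀]
  [Nonempty ι₀] (S : ι₀ → Subgroup (Field.absoluteGaloisGroup k)) (hS : ∀ ⦃i j : ι₀⦄, i ≤ j → S j ≤ S i)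

/-! ## §1 `Ẑ^×`-rigidity of the Kummer container of a number field relative to `F_mod^×` and one `𝒪^⊿_𝔭` -/

/-- **`Ẑ^×`-rigidity of the arithmetic Kummer container** ([IUTchI] Ex. 5.1 (v) p. 128, the uniqueness half
of the second display, read at the genuine container of the number field `k = F_mod`): if `u ∈ Ẑ^× = Aut(Ẑ)`
twists the Kummer container `lim_{→ i} H¹(S i, Λ(k̄ˣ))` so as to carry the layer `κ(kˣ)` into itself AND the
integral submonoid `κ(𝒪^⊿_𝔭) = κ({x : v_𝔭(x) ≤ 1})` into itself for ONE finite prime `𝔭`, then `u = 1`.  Proof: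
laws (V)(I) of `exists_valuation_laws_numberField` and a uniformiser `π` at `𝔭` [`ord_𝔭(π) = 1 > 0`, its twist is
again integral, so of order `≥ 0`], whence `u = 1` by `ℚ_{>0} ∩ Ẑ^× = {1}`
(`CyclotomeRigidity.eq_one_of_pos_of_nonneg`). [cite: Mochizuki2012, IUTchI Ex. 5.1 (v) p. 128]
[claim: Mochizuki2012, status: disputed] [cite: LANA2026Report, §6.1 pp. 31–32] -/
theorem KummerContainer.eq_one_of_mapsTo_layer_integral (hc : IsExhausted (AlgebraicClosure k)ˣ S)
    (hfin : ∀ i, ∃ L : IntermediateField k (AlgebraicClosure k), FiniteDimensional k L ∧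
      ∀ σ : Field.absoluteGaloisGroup k, Field.absoluteGaloisGroup.toAlgEquiv k σ ∈ L.fixingSubgroup → σ ∈ S i)
    (u : MulAut (completion (GrpCat.of (Multiplicative ℤ))))
    (hlayer : Set.MapsTo (H1ColimTwist S hS u)
      (Set.range fun x : kˣ =>
        kummerMap hS hc (Units.map (algebraMap k (AlgebraicClosure k) : k →* AlgebraicClosure k) x))
      (Set.range fun x : kˣ =>
        kummerMap hS hc (Units.map (algebraMap k (AlgebraicClosure k) : k →* AlgebraicClosure k) x)))
    (𝔭 : HeightOneSpectrum (𝓞 k))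
    (hint : Set.MapsTo (H1ColimTwist S hS u)
      ((fun x : kˣ =>
          kummerMap hS hc (Units.map (algebraMap k (AlgebraicClosure k) : k →* AlgebraicClosure k) x)) ''
        {x : kˣ | 𝔭.valuation k (x : k) ≤ 1})
      ((fun x : kˣ =>
          kummerMap hS hc (Units.map (algebraMap k (AlgebraicClosure k) : k →* AlgebraicClosure k) x)) ''
        {x : kˣ | 𝔭.valuation k (x : k) ≤ 1})) :
    u = 1 := by
  obtain ⟨val, hread, hV, hI, -⟩ := exists_valuation_laws_numberField k S hS hc hfin
  -- a uniformiser `π` at `𝔭`: integral, of order `1`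
  obtain ⟨π, hπ⟩ := 𝔭.valuation_exists_uniformizer k
  have hπ0 : π ≠ 0 := by
    rintro rfl
    rw [map_zero] at hπ
    exact WithZero.exp_ne_zero hπ.symm
  have hx1 : 𝔭.valuation k ((Units.mk0 π hπ0 : kˣ) : k) ≤ 1 := by
    rw [Units.val_mk0, hπ, ← WithZero.exp_zero, WithZero.exp_le_exp]
    norm_num
  have hval1 : val 𝔭 (kummerMap hS hc
      (Units.map (algebraMap k (AlgebraicClosure k) : k →* AlgebraicClosure k) (Units.mk0 π hπ0))) = 1 := by
    rw [hread]
    have h := 𝔭.valuationOfNeZero_eq (K := k) (Units.mk0 π hπ0)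
    rw [Units.val_mk0, hπ, WithZero.exp_eq_coe_ofAdd, WithZero.coe_inj] at h
    rw [h, toAdd_ofAdd]
    norm_num
  -- `κ(π)` lies in the layer and in `κ(𝒪^⊿_𝔭)`; its twist again does, so has order `≥ 0`
  exact CyclotomeRigidity.eq_one_of_pos_of_nonneg u (by rw [hval1]; exact one_pos)
    (hI 𝔭 _ (hlayer ⟨Units.mk0 π hπ0, rfl⟩) (hint ⟨Units.mk0 π hπ0, hx1, rfl⟩))
    (hV u hlayer _ ⟨Units.mk0 π hπ0, rfl⟩ 𝔭)

/-- **The same rigidity read on the cyclotome** (`Aut(Λ(k̄ˣ)) = Ẑ^×` on the nose,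
`cyclotome.zhatTwist_bijective_of_isSepClosed`): an automorphism `w` of `Λ(k̄ˣ) = μ_Ẑ(k̄)` whose cyclotomic
parameter twists the container compatibly with `κ(kˣ)` and with one `κ(𝒪^⊿_𝔭)` is the identity.
[cite: Mochizuki2012, IUTchI Ex. 5.1 (v) p. 128] [claim: Mochizuki2012, status: disputed]
[cite: MochizukiAbsTopIII2015, Proposition 3.3 (ii) p.74] -/
theorem KummerContainer.cyclotomeAut_eq_one_of_mapsTo_layer_integral (hc : IsExhausted (AlgebraicClosure k)ˣ S)
    (hfin : ∀ i, ∃ L : IntermediateField k (AlgebraicClosure k), FiniteDimensional k L ∧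
      ∀ σ : Field.absoluteGaloisGroup k, Field.absoluteGaloisGroup.toAlgEquiv k σ ∈ L.fixingSubgroup → σ ∈ S i)
    (w : MulAut (cyclotome (AlgebraicClosure k)ˣ))
    (hlayer : Set.MapsTo
      (H1ColimTwist S hS ((MulEquiv.ofBijective (cyclotome.zhatTwist (AlgebraicClosure k)ˣ)
        (cyclotome.zhatTwist_bijective_of_isSepClosed (AlgebraicClosure k))).symm w))
      (Set.range fun x : kˣ =>
        kummerMap hS hc (Units.map (algebraMap k (AlgebraicClosure k) : k →* AlgebraicClosure k) x))
      (Set.range fun x : kˣ =>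
        kummerMap hS hc (Units.map (algebraMap k (AlgebraicClosure k) : k →* AlgebraicClosure k) x)))
    (𝔭 : HeightOneSpectrum (𝓞 k))
    (hint : Set.MapsTo
      (H1ColimTwist S hS ((MulEquiv.ofBijective (cyclotome.zhatTwist (AlgebraicClosure k)ˣ)
        (cyclotome.zhatTwist_bijective_of_isSepClosed (AlgebraicClosure k))).symm w))
      ((fun x : kˣ =>
          kummerMap hS hc (Units.map (algebraMap k (AlgebraicClosure k) : k →* AlgebraicClosure k) x)) ''
        {x : kˣ | 𝔭.valuation k (x : k) ≤ 1})
      ((fun x : kˣ =>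
          kummerMap hS hc (Units.map (algebraMap k (AlgebraicClosure k) : k →* AlgebraicClosure k) x)) ''
        {x : kˣ | 𝔭.valuation k (x : k) ≤ 1})) :
    w = 1 := by
  have hu := KummerContainer.eq_one_of_mapsTo_layer_integral k S hS hc hfin _ hlayer 𝔭 hint
  rw [← (MulEquiv.ofBijective (cyclotome.zhatTwist (AlgebraicClosure k)ˣ)
    (cyclotome.zhatTwist_bijective_of_isSepClosed (AlgebraicClosure k))).apply_symm_apply w, hu, map_one]

/-! ## §2 The display's comparison family at the genuine container: the such-that clause pins `e = e₀` -/

/-- **Ex. 5.1 (v), p. 128, second display, AT THE GENUINE KUMMER CONTAINER — the such-that clause holds for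
`e₀` and for nothing else.**  Family: source cyclotome `μ` with its chosen identification `e₀ : μ ⥲ Λ(k̄ˣ)`
[[AbsTopIII] Thm 1.9 (d)], target `Λ(k̄ˣ)`, both containers `lim_{→ i} H¹(S i, Λ(k̄ˣ))`, layers `L` with
`L i₀ = κ(kˣ)`, integral submonoids `κ(𝒪^⊿_𝔭)` (all finite `𝔭`), induced map of `e` = the container twist by the
cyclotomic parameter of `e ∘ e₀⁻¹`.  (⇐) `e₀ ∘ e₀⁻¹ = 1` twists by `1 ∈ Ẑ^×`, i.e. trivially
(`H1ColimTwist_one_apply`), so every layer and every `𝒪^⊿_𝔭` is carried bijectively onto itself; (⇒) the clause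
at the layer `i₀` and at one `𝒪^⊿_𝔭` forces the parameter to be `1` (§1), so `e ∘ e₀⁻¹ = 1`.
[cite: Mochizuki2012, IUTchI Ex. 5.1 (v) p. 128] [claim: Mochizuki2012, status: disputed]
[cite: LANA2026Report, §6.1 pp. 31–32] -/
theorem numberFieldModel_inducesCompatibleIsos_iff (hc : IsExhausted (AlgebraicClosure k)ˣ S)
    (hfin : ∀ i, ∃ L : IntermediateField k (AlgebraicClosure k), FiniteDimensional k L ∧
      ∀ σ : Field.absoluteGaloisGroup k, Field.absoluteGaloisGroup.toAlgEquiv k σ ∈ L.fixingSubgroup → σ ∈ S i)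
    (μ : Type) [CommGroup μ] (e₀ : μ ≃* cyclotome (AlgebraicClosure k)ˣ) {ι : Type w}
    (L : ι → Set (H1Colimit (AlgebraicClosure k)ˣ S hS)) (i₀ : ι)
    (hL : L i₀ = Set.range fun x : kˣ =>
      kummerMap hS hc (Units.map (algebraMap k (AlgebraicClosure k) : k →* AlgebraicClosure k) x))
    (e : μ ≃* cyclotome (AlgebraicClosure k)ˣ) :
    ({ μ₁ := μ, μ₂ := cyclotome (AlgebraicClosure k)ˣ,
        H₁ := H1Colimit (AlgebraicClosure k)ˣ S hS, H₂ := H1Colimit (AlgebraicClosure k)ˣ S hS,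
        im₁ := L, im₂ := L,
        int₁ := fun 𝔭 : HeightOneSpectrum (𝓞 k) => (fun x : kˣ =>
            kummerMap hS hc (Units.map (algebraMap k (AlgebraicClosure k) : k →* AlgebraicClosure k) x)) ''
          {x : kˣ | 𝔭.valuation k (x : k) ≤ 1},
        int₂ := fun 𝔭 : HeightOneSpectrum (𝓞 k) => (fun x : kˣ =>
            kummerMap hS hc (Units.map (algebraMap k (AlgebraicClosure k) : k →* AlgebraicClosure k) x)) ''
          {x : kˣ | 𝔭.valuation k (x : k) ≤ 1},
        induced := fun e' h => H1ColimTwist S hS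
          ((MulEquiv.ofBijective (cyclotome.zhatTwist (AlgebraicClosure k)ˣ)
            (cyclotome.zhatTwist_bijective_of_isSepClosed (AlgebraicClosure k))).symm (e₀.symm.trans e')) h } :
      CyclotomeComparisonFamily ι (HeightOneSpectrum (𝓞 k))).InducesCompatibleIsos e ↔ e = e₀ := by
  -- a finite prime of `k` exists (`𝓞 k` is not a field)
  obtain ⟨M, hM⟩ := Ideal.exists_maximal (𝓞 k)
  let 𝔭₀ : HeightOneSpectrum (𝓞 k) :=
    ⟨M, hM.isPrime, Ring.ne_bot_of_isMaximal_of_not_isField hM (RingOfIntegers.not_isField k)⟩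
  constructor
  · intro he
    -- the clause at the layer `i₀` and at `𝒪^⊿_{𝔭₀}` forces the parameter of `e ∘ e₀⁻¹` to be `1`
    have hlayer : Set.MapsTo
        (H1ColimTwist S hS ((MulEquiv.ofBijective (cyclotome.zhatTwist (AlgebraicClosure k)ˣ)
          (cyclotome.zhatTwist_bijective_of_isSepClosed (AlgebraicClosure k))).symm (e₀.symm.trans e)))
        (Set.range fun x : kˣ =>
          kummerMap hS hc (Units.map (algebraMap k (AlgebraicClosure k) : k →* AlgebraicClosure k) x))
        (Set.range fun x : kˣ =>
          kummerMap hS hc (Units.map (algebraMap k (AlgebraicClosure k) : k →* AlgebraicClosure k) x)) := by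
      rw [← hL]
      exact (he.1 i₀).mapsTo
    have hw : e₀.symm.trans e = 1 :=
      KummerContainer.cyclotomeAut_eq_one_of_mapsTo_layer_integral k S hS hc hfin _ hlayer 𝔭₀ (he.2 𝔭₀).mapsTo
    refine MulEquiv.ext fun x => ?_
    have hx := MulEquiv.congr_fun hw (e₀ x)
    rwa [MulEquiv.trans_apply, MulEquiv.symm_apply_apply, MulAut.one_apply] at hx
  · intro he
    rw [he]
    -- `e₀ ∘ e₀⁻¹ = 1` has parameter `1`, which twists trivially
    have h1 : (MulEquiv.ofBijective (cyclotome.zhatTwist (AlgebraicClosure k)ˣ)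
        (cyclotome.zhatTwist_bijective_of_isSepClosed (AlgebraicClosure k))).symm (e₀.symm.trans e₀) = 1 := by
      rw [MulEquiv.symm_trans_self]
      exact map_one _
    have hone : ∀ h : H1Colimit (AlgebraicClosure k)ˣ S hS, H1ColimTwist S hS
        ((MulEquiv.ofBijective (cyclotome.zhatTwist (AlgebraicClosure k)ˣ)
          (cyclotome.zhatTwist_bijective_of_isSepClosed (AlgebraicClosure k))).symm (e₀.symm.trans e₀)) h = h :=
      fun h => by rw [h1, H1ColimTwist_one_apply]
    exact ⟨fun i => (Set.bijOn_id _).congr fun h _ => (hone h).symm,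
      fun 𝔭 => (Set.bijOn_id _).congr fun h _ => (hone h).symm⟩

/-- **Ex. 5.1 (v), p. 128, second display — `UniqueCyclotomeIsoFamily` HOLDS at the genuine Kummer container of
the number field `k`** (FACT-LIST F-2577 instantiated at genuine arithmetic data): there is EXACTLY ONE
isomorphism of cyclotomes `μ ⥲ Λ(k̄ˣ)` whose induced map of containers carries every layer and every integral
submonoid `𝒪^⊿_𝔭` bijectively onto its counterpart — namely the chosen identification `e₀`.
[cite: Mochizuki2012, IUTchI Ex. 5.1 (v) p. 128] [claim: Mochizuki2012, status: disputed]
[cite: LANA2026Report, §6.1 pp. 31–32] -/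
theorem uniqueCyclotomeIsoFamily_numberFieldModel (hc : IsExhausted (AlgebraicClosure k)ˣ S)
    (hfin : ∀ i, ∃ L : IntermediateField k (AlgebraicClosure k), FiniteDimensional k L ∧
      ∀ σ : Field.absoluteGaloisGroup k, Field.absoluteGaloisGroup.toAlgEquiv k σ ∈ L.fixingSubgroup → σ ∈ S i)
    (μ : Type) [CommGroup μ] (e₀ : μ ≃* cyclotome (AlgebraicClosure k)ˣ) {ι : Type w}
    (L : ι → Set (H1Colimit (AlgebraicClosure k)ˣ S hS)) (i₀ : ι)
    (hL : L i₀ = Set.range fun x : kˣ =>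
      kummerMap hS hc (Units.map (algebraMap k (AlgebraicClosure k) : k →* AlgebraicClosure k) x)) :
    UniqueCyclotomeIsoFamily
      ({ μ₁ := μ, μ₂ := cyclotome (AlgebraicClosure k)ˣ,
          H₁ := H1Colimit (AlgebraicClosure k)ˣ S hS, H₂ := H1Colimit (AlgebraicClosure k)ˣ S hS,
          im₁ := L, im₂ := L,
          int₁ := fun 𝔭 : HeightOneSpectrum (𝓞 k) => (fun x : kˣ =>
              kummerMap hS hc (Units.map (algebraMap k (AlgebraicClosure k) : k →* AlgebraicClosure k) x)) ''
            {x : kˣ | 𝔭.valuation k (x : k) ≤ 1},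
          int₂ := fun 𝔭 : HeightOneSpectrum (𝓞 k) => (fun x : kˣ =>
              kummerMap hS hc (Units.map (algebraMap k (AlgebraicClosure k) : k →* AlgebraicClosure k) x)) ''
            {x : kˣ | 𝔭.valuation k (x : k) ≤ 1},
          induced := fun e' h => H1ColimTwist S hS
            ((MulEquiv.ofBijective (cyclotome.zhatTwist (AlgebraicClosure k)ˣ)
              (cyclotome.zhatTwist_bijective_of_isSepClosed (AlgebraicClosure k))).symm (e₀.symm.trans e')) h } :
        CyclotomeComparisonFamily ι (HeightOneSpectrum (𝓞 k))) :=
  ⟨⟨e₀, (numberFieldModel_inducesCompatibleIsos_iff k S hS hc hfin μ e₀ L i₀ hL e₀).2 rfl, fun e he =>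
    (numberFieldModel_inducesCompatibleIsos_iff k S hS hc hfin μ e₀ L i₀ hL e).1 he⟩⟩

/-! ## §3 The closer of record FIRES at the genuine container: laws (E)(T)(V)(I)(P) instantiated -/

/-- **Laws (E)(T)(V)(I)(P) of `UniqueCyclotomeIsoFamily.of_integral_laws` AT THE GENUINE KUMMER CONTAINER**
(GAP-LEDGER G-w4d057g4-1: "instantiation at the genuine Kummer map").  At the family of
`uniqueCyclotomeIsoFamily_numberFieldModel`, with the GENUINE torsor structure `zμ u e := (zhatTwist u) ∘ e`
[`Ẑ^× = Aut(Ẑ)` acting simply transitively on the isomorphisms of cyclotomes `μ ⥲ Λ(k̄ˣ)`, since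
`Aut(Λ(k̄ˣ)) = Ẑ^×`], the container action `twist u := H1ColimTwist u` and the order readings `val 𝔭` of
`exists_valuation_laws_numberField`: (E) `e₀` satisfies the clause; (T) `e′ = zμ u e` with `u` := the parameter of
`e′ ∘ e⁻¹`, and `induced e′ = twist u ∘ induced e` (functoriality `H1ColimTwist_mul_apply`); (V) valuation
transport; (I) integrality; (P) positivity — ALL HOLD, and the closer yields `UniqueCyclotomeIsoFamily`.
[cite: Mochizuki2012, IUTchI Ex. 5.1 (v) p. 128] [claim: Mochizuki2012, status: disputed]
[cite: LANA2026Report, §6.1 pp. 31–32] -/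
theorem numberFieldModel_integral_laws (hc : IsExhausted (AlgebraicClosure k)ˣ S)
    (hfin : ∀ i, ∃ L : IntermediateField k (AlgebraicClosure k), FiniteDimensional k L ∧
      ∀ σ : Field.absoluteGaloisGroup k, Field.absoluteGaloisGroup.toAlgEquiv k σ ∈ L.fixingSubgroup → σ ∈ S i)
    (μ : Type) [CommGroup μ] (e₀ : μ ≃* cyclotome (AlgebraicClosure k)ˣ) {ι : Type w}
    (L : ι → Set (H1Colimit (AlgebraicClosure k)ˣ S hS)) (i₀ : ι)
    (hL : L i₀ = Set.range fun x : kˣ =>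
      kummerMap hS hc (Units.map (algebraMap k (AlgebraicClosure k) : k →* AlgebraicClosure k) x)) :
    let C : CyclotomeComparisonFamily ι (HeightOneSpectrum (𝓞 k)) :=
      { μ₁ := μ, μ₂ := cyclotome (AlgebraicClosure k)ˣ,
        H₁ := H1Colimit (AlgebraicClosure k)ˣ S hS, H₂ := H1Colimit (AlgebraicClosure k)ˣ S hS,
        im₁ := L, im₂ := L,
        int₁ := fun 𝔭 : HeightOneSpectrum (𝓞 k) => (fun x : kˣ =>
            kummerMap hS hc (Units.map (algebraMap k (AlgebraicClosure k) : k →* AlgebraicClosure k) x)) ''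
          {x : kˣ | 𝔭.valuation k (x : k) ≤ 1},
        int₂ := fun 𝔭 : HeightOneSpectrum (𝓞 k) => (fun x : kˣ =>
            kummerMap hS hc (Units.map (algebraMap k (AlgebraicClosure k) : k →* AlgebraicClosure k) x)) ''
          {x : kˣ | 𝔭.valuation k (x : k) ≤ 1},
        induced := fun e' h => H1ColimTwist S hS
          ((MulEquiv.ofBijective (cyclotome.zhatTwist (AlgebraicClosure k)ˣ)
            (cyclotome.zhatTwist_bijective_of_isSepClosed (AlgebraicClosure k))).symm (e₀.symm.trans e')) h }
    ∃ val : HeightOneSpectrum (𝓞 k) → C.H₂ → ℤ,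
      -- (E)
      (∃ e, C.InducesCompatibleIsos e) ∧
      -- (T), with `zμ u e := e.trans (zhatTwist u)` and `twist := H1ColimTwist`
      (∀ e e' : C.μ₁ ≃* C.μ₂, ∃ u : MulAut (completion (GrpCat.of (Multiplicative ℤ))),
        e' = e.trans (cyclotome.zhatTwist (AlgebraicClosure k)ˣ u) ∧
          ∀ h, C.induced e' h = H1ColimTwist S hS u (C.induced e h)) ∧
      -- (V)
      (∀ u : MulAut (completion (GrpCat.of (Multiplicative ℤ))),
        Set.MapsTo (H1ColimTwist S hS u) (C.im₂ i₀) (C.im₂ i₀) →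
          ∀ h ∈ C.im₂ i₀, ∀ 𝔭 : HeightOneSpectrum (𝓞 k),
            u (eta (val 𝔭 h)) = eta (val 𝔭 (H1ColimTwist S hS u h))) ∧
      -- (I)
      (∀ 𝔭 : HeightOneSpectrum (𝓞 k), ∀ h ∈ C.im₂ i₀, h ∈ C.int₂ 𝔭 → 0 ≤ val 𝔭 h) ∧
      -- (P)
      (∃ 𝔭₀ : HeightOneSpectrum (𝓞 k), ∃ h ∈ C.im₂ i₀, h ∈ C.int₂ 𝔭₀ ∧ 0 < val 𝔭₀ h) ∧
      -- … and the closer of record (abc-iut-w4-d057's `of_integral_laws`, p427568) FIRES on these laws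
      UniqueCyclotomeIsoFamily C := by
  intro C
  obtain ⟨val, -, hV, hI, hP⟩ := exists_valuation_laws_numberField k S hS hc hfin
  have him : C.im₂ i₀ = Set.range fun x : kˣ =>
      kummerMap hS hc (Units.map (algebraMap k (AlgebraicClosure k) : k →* AlgebraicClosure k) x) := hL
  have hex : ∃ e, C.InducesCompatibleIsos e :=
    ⟨e₀, (numberFieldModel_inducesCompatibleIsos_iff k S hS hc hfin μ e₀ L i₀ hL e₀).2 rfl⟩
  have hval : ∀ u : MulAut (completion (GrpCat.of (Multiplicative ℤ))),
      Set.MapsTo (H1ColimTwist S hS u) (C.im₂ i₀) (C.im₂ i₀) →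
        ∀ h ∈ C.im₂ i₀, ∀ 𝔭 : HeightOneSpectrum (𝓞 k),
          u (eta (val 𝔭 h)) = eta (val 𝔭 (H1ColimTwist S hS u h)) := by
    rw [him]; exact hV
  have hint : ∀ 𝔭 : HeightOneSpectrum (𝓞 k), ∀ h ∈ C.im₂ i₀, h ∈ C.int₂ 𝔭 → 0 ≤ val 𝔭 h := by
    rw [him]; exact hI
  have hpos : ∃ 𝔭₀ : HeightOneSpectrum (𝓞 k), ∃ h ∈ C.im₂ i₀, h ∈ C.int₂ 𝔭₀ ∧ 0 < val 𝔭₀ h := by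
    rw [him]; exact hP
  suffices htors : ∀ e e' : C.μ₁ ≃* C.μ₂, ∃ u : MulAut (completion (GrpCat.of (Multiplicative ℤ))),
      e' = e.trans (cyclotome.zhatTwist (AlgebraicClosure k)ˣ u) ∧
        ∀ h, C.induced e' h = H1ColimTwist S hS u (C.induced e h) from
    ⟨val, hex, htors, hval, hint, hpos,
      UniqueCyclotomeIsoFamily.of_integral_laws C i₀
        (fun u e => e.trans (cyclotome.zhatTwist (AlgebraicClosure k)ˣ u)) (fun e => by rw [map_one]; rfl)
        (fun u h => H1ColimTwist S hS u h) hex htors val hval hint hpos⟩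
  intro e e'
  -- (T): the parameter of `e' ∘ e⁻¹`
  have happ : ∀ y : MulAut (cyclotome (AlgebraicClosure k)ˣ), cyclotome.zhatTwist (AlgebraicClosure k)ˣ
      ((MulEquiv.ofBijective (cyclotome.zhatTwist (AlgebraicClosure k)ˣ)
        (cyclotome.zhatTwist_bijective_of_isSepClosed (AlgebraicClosure k))).symm y) = y := fun y =>
    (MulEquiv.ofBijective (cyclotome.zhatTwist (AlgebraicClosure k)ˣ)
      (cyclotome.zhatTwist_bijective_of_isSepClosed (AlgebraicClosure k))).apply_symm_apply y
  refine ⟨(MulEquiv.ofBijective (cyclotome.zhatTwist (AlgebraicClosure k)ˣ)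
    (cyclotome.zhatTwist_bijective_of_isSepClosed (AlgebraicClosure k))).symm (e.symm.trans e'), ?_, fun h => ?_⟩
  · rw [happ]
    exact MulEquiv.ext fun x => by
      rw [MulEquiv.trans_apply, MulEquiv.trans_apply, MulEquiv.symm_apply_apply]
  · -- `e' ∘ e₀⁻¹ = (e' ∘ e⁻¹) ∘ (e ∘ e₀⁻¹)`, and the parameter is multiplicative
    have hprod : e₀.symm.trans e' = (e.symm.trans e') * (e₀.symm.trans e) :=
      MulEquiv.ext fun x => by
        rw [MulAut.mul_apply, MulEquiv.trans_apply, MulEquiv.trans_apply, MulEquiv.trans_apply,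
          MulEquiv.symm_apply_apply]
    have key : H1ColimTwist S hS
        ((MulEquiv.ofBijective (cyclotome.zhatTwist (AlgebraicClosure k)ˣ)
          (cyclotome.zhatTwist_bijective_of_isSepClosed (AlgebraicClosure k))).symm (e₀.symm.trans e')) h =
        H1ColimTwist S hS
          ((MulEquiv.ofBijective (cyclotome.zhatTwist (AlgebraicClosure k)ˣ)
            (cyclotome.zhatTwist_bijective_of_isSepClosed (AlgebraicClosure k))).symm (e.symm.trans e'))
          (H1ColimTwist S hS
            ((MulEquiv.ofBijective (cyclotome.zhatTwist (AlgebraicClosure k)ˣ)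
              (cyclotome.zhatTwist_bijective_of_isSepClosed (AlgebraicClosure k))).symm (e₀.symm.trans e)) h) := by
      rw [hprod, map_mul, H1ColimTwist_mul_apply]
    exact key

/-! ## §4 The `AstLayer` instance: layers `⊛ ↦ κ(k̄ˣ)`, `sol ↦ κ(Fˣ)`, `mod ↦ κ(kˣ)` -/

/-- **Ex. 5.1 (v), p. 128, second display with `ι = AstLayer`, at the Kummer container of the number field `k`**
(self-identification `e₀ = id` of `Λ(k̄ˣ)`): layers `⊛ ↦ κ(k̄ˣ)` [`F̄^×`], `sol ↦ κ(Fˣ)` for an intermediate field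
`k ⊆ F ⊆ k̄` [print: `F_sol`], `mod ↦ κ(kˣ)` [`F_mod^×`], integral submonoids `κ(𝒪^⊿_𝔭)` at every finite prime of
`k`, induced map = the container twist by the cyclotomic parameter: `UniqueCyclotomeIsoFamily` HOLDS, the unique
isomorphism being the identity of `Λ(k̄ˣ)`. [cite: Mochizuki2012, IUTchI Ex. 5.1 (v) p. 128]
[claim: Mochizuki2012, status: disputed] [cite: LANA2026Report, §6.1 pp. 31–32] -/
theorem uniqueCyclotomeIsoFamily_numberField_astLayer (hc : IsExhausted (AlgebraicClosure k)ˣ S)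
    (hfin : ∀ i, ∃ L : IntermediateField k (AlgebraicClosure k), FiniteDimensional k L ∧
      ∀ σ : Field.absoluteGaloisGroup k, Field.absoluteGaloisGroup.toAlgEquiv k σ ∈ L.fixingSubgroup → σ ∈ S i)
    (F : IntermediateField k (AlgebraicClosure k)) :
    UniqueCyclotomeIsoFamily
      ({ μ₁ := cyclotome (AlgebraicClosure k)ˣ, μ₂ := cyclotome (AlgebraicClosure k)ˣ,
          H₁ := H1Colimit (AlgebraicClosure k)ˣ S hS, H₂ := H1Colimit (AlgebraicClosure k)ˣ S hS,
          im₁ := fun i : AstLayer => match i with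
            | .ast => Set.range (kummerMap hS hc)
            | .sol => Set.range fun x : Fˣ =>
                kummerMap hS hc (Units.map (algebraMap F (AlgebraicClosure k) : F →* AlgebraicClosure k) x)
            | .mod => Set.range fun x : kˣ =>
                kummerMap hS hc (Units.map (algebraMap k (AlgebraicClosure k) : k →* AlgebraicClosure k) x),
          im₂ := fun i : AstLayer => match i with
            | .ast => Set.range (kummerMap hS hc)
            | .sol => Set.range fun x : Fˣ =>
                kummerMap hS hc (Units.map (algebraMap F (AlgebraicClosure k) : F →* AlgebraicClosure k) x)
            | .mod => Set.range fun x : kˣ =>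
                kummerMap hS hc (Units.map (algebraMap k (AlgebraicClosure k) : k →* AlgebraicClosure k) x),
          int₁ := fun 𝔭 : HeightOneSpectrum (𝓞 k) => (fun x : kˣ =>
              kummerMap hS hc (Units.map (algebraMap k (AlgebraicClosure k) : k →* AlgebraicClosure k) x)) ''
            {x : kˣ | 𝔭.valuation k (x : k) ≤ 1},
          int₂ := fun 𝔭 : HeightOneSpectrum (𝓞 k) => (fun x : kˣ =>
              kummerMap hS hc (Units.map (algebraMap k (AlgebraicClosure k) : k →* AlgebraicClosure k) x)) ''
            {x : kˣ | 𝔭.valuation k (x : k) ≤ 1},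
          induced := fun e' h => H1ColimTwist S hS
            ((MulEquiv.ofBijective (cyclotome.zhatTwist (AlgebraicClosure k)ˣ)
              (cyclotome.zhatTwist_bijective_of_isSepClosed (AlgebraicClosure k))).symm
                ((MulEquiv.refl (cyclotome (AlgebraicClosure k)ˣ)).symm.trans e')) h } :
        CyclotomeComparisonFamily AstLayer (HeightOneSpectrum (𝓞 k))) :=
  uniqueCyclotomeIsoFamily_numberFieldModel k S hS hc hfin (cyclotome (AlgebraicClosure k)ˣ) (MulEquiv.refl _)
    _ AstLayer.mod rfl

end Literature.IUT.HodgeTheaters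

end
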